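import Summits.BirchSwinnertonDyer.Rank1Residual.X11b.BDPRouteUpperLinksField
import Summits.BirchSwinnertonDyer.Rank1Residual.X11b.BDPRouteUpperLinksInertTwo
import HarnessLib

/-!
# Class X11b, route "BDP + converse-theorem engine + Kolyvagin": the numeric Tamagawa condition for the JSW §7.4.2 field with `2` allowed in `N⁻`, and the class-level assembly on ALL of (T2β)∖(T2α) (cell `b2b-bsdres`, sub-cell `multr1-p2`, gen 9)

HONEST FRAMING (verbatim, cell `b2b-bsdres`): the goal of the cell is to DELETE the
COMBINATION-SHAPED residual classes for ALL analytic-rank `≤ 1` curves over `ℚ` — "full BSD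
formula for every rank `≤ 1` curve in class `C`" assembled STRICTLY from published theorems — so
that the rank-`≤ 1` remainder becomes exactly the CONSTRUCTION-SHAPED classes, which are TYPED
(missing-input Props), NOT attempted; this is not "finishing BSD". Research route `p2` for class
X11b; no claim beyond the stated class; nothing booked; X11b stays CONSTRUCTION-SHAPED. Theorems
only (no definition, no new named fact).

## What this file does

`BDPRouteUpperLinksField.lean` proved the numeric Tamagawa condition of the two Shimura-curve shapes
for an inert set `S` of ODD primes; `BDPRouteUpperLinksInertTwo.lean` supplied the local step at an
inert `2` (`d_K ≡ 5 mod 8`). Here the two are combined: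

* `padicValNat_tamagawaProduct_add_twist_le_of_inertSet'` — `S` any finite set of primes, each
  multiplicative for `E` and INERT in `K` (`(d_K/ℓ) = −1` for odd `ℓ`, `d_K ≡ 5 (mod 8)` for
  `ℓ = 2`), every other bad prime split, every split multiplicative `ℓ ∉ S` très ramifié:
  `ord_p ∏c(E) + ord_p ∏c(E^{d_K}) ≤ Σ_{ℓ ∈ S} ord_p(ord_ℓ Δ_min(E))`;
* `missingUpperBoundAt_of_classX11b_of_shimuraShapes_inertSet'` — the class-level assembly: on an
  X11b pair with `p ≥ 5` and a (ram) witness (inside or outside `S`, `2` allowed), such a field, a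
  point `P ∈ E(K)` carrying (U-Sh) and (GZ-Sh) with `T = Σ_{ℓ∈S} ord_p(ord_ℓ Δ_min(E))`, and the
  PUBLISHED facts `hSk` (Skinner 2016 Thm. C), `hGZK`, `hmod` give `Typed.MissingUpperBoundAt E p`.

Census (`HOME/b2b-bsdres-multr1-p2/shcensus/`, 2 267 348 X11b-shape pairs, `N < 5·10⁵` ‖ `N < 2·10⁴`):
every pair of (T2β)∖(T2α) — 41 174 ‖ 1 372, two thirds of the (ram) ∧ `p ∣ ∏c` atom — admits such
`(S, ℓ₀)` (`S` = the offending primes `ℓ ≠ p`, padded to even size by a (ram) witness when odd). So on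
the whole sub-shape (T2β)∖(T2α) the Euler-system half of `BSD(E,p)` rests on EXACTLY: the two
displayed statements of Jetchev–Skinner–Wan 2017 §7.4.2 ((U-Sh) = Thm. 4.4.1, refereed, printed
under (split) `p = v v̄`; (GZ-Sh) = explicit Gross–Zagier on `X_{N⁺,N⁻}` in BSD normalisation at
`p ∥ N`), the CM point `z_K^{N⁺,N⁻} ∈ E(K)`, and a Friedberg–Hoffstein field with these local
conditions and `L(E^{d_K},1) ≠ 0` — none typed in the tree (SPEC
`HOME/b2b-bsdres-multr1-p2/SHIMURA-UPPER-HALF-SPEC.md` §5). The complementary sub-shape (T2α) (split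
and peu ramifié at `p`; 20 824 ‖ 777) has no printed road (`p` would have to be inert).
CONDITIONAL; nothing booked; labels unchanged.

References: [JetchevSkinnerWan2017] §7.4.2 (p. 31), Thm. 4.4.1 (p. 19), §4.1 (H) (p. 17);
[Skinner2016PacificMC] Thm. C; [SilvermanATAEC1994] Cor. IV.9.2; [SilvermanAEC2009] VII.5, App. A;
[Miller2011LMS] Def. 1.1.
-/

noncomputable section

open scoped Classical

open WeierstrassCurve NumberField IsDedekindDomain Literature.NumberTheory.EllipticCurves
  Rat.HeightOneSpectrum
  Literature.NumberTheory.EllipticCurves.Rank1Residual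
  Literature.NumberTheory.EllipticCurves.Rank1Residual.Typed
  Literature.NumberTheory.EllipticCurves.ModularForms

namespace Summit.BirchSwinnertonDyer.Rank1Residual.X11b

/-- `ord_p` of a finite product of non-zero naturals is the sum of the `ord_p`. [folklore] -/
private theorem padicValNat_finset_prod'' (p : ℕ) [Fact p.Prime] {ι : Type*} (s : Finset ι)
    (f : ι → ℕ) (hf : ∀ i ∈ s, f i ≠ 0) :
    padicValNat p (∏ i ∈ s, f i) = ∑ i ∈ s, padicValNat p (f i) := by
  induction s using Finset.induction_on with
  | empty => simp
  | insert a s ha ih =>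
    rw [Finset.prod_insert ha, Finset.sum_insert ha,
      padicValNat.mul (hf a (Finset.mem_insert_self a s))
        (Finset.prod_ne_zero_iff.mpr fun i hi => hf i (Finset.mem_insert_of_mem hi)),
      ih fun i hi => hf i (Finset.mem_insert_of_mem hi)]

/-- **The numeric Tamagawa condition for the field of JSW §7.4.2, `2` allowed in `N⁻`.** As
`padicValNat_tamagawaProduct_add_twist_le_of_inertSet`, with the inert set `S` allowed to contain `2`
(inertness at `2` = `d_K ≡ 5 (mod 8)`; at odd `ℓ` = `(d_K/ℓ) = −1`).
[cite: JetchevSkinnerWan2017, §7.4.2 (p. 31) and §7.3.1 (eq:tamK)]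
[cite: SilvermanATAEC1994, Cor. IV.9.2(d) with (b) (PDF p. 340)] -/
theorem padicValNat_tamagawaProduct_add_twist_le_of_inertSet'
    (W : WeierstrassCurve ℚ) [W.IsElliptic] [W.IsGloballyMinimal] (p : ℕ) [Fact p.Prime]
    (hp5 : 5 ≤ p) (K : Type) [Field K] [NumberField K]
    {Wd : WeierstrassCurve ℚ} [Wd.IsElliptic] [Wd.IsGloballyMinimal] (Cd : VariableChange ℚ)
    (hWd : Cd • W.quadraticTwist (NumberField.discr K : ℚ) = Wd)
    (S : Finset ℕ)
    (hS : ∀ ℓ ∈ S, ∃ _ : Fact ℓ.Prime, Mult W ℓ ∧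
      ((ℓ ≠ 2 ∧ jacobiSym (NumberField.discr K) ℓ = -1) ∨ (ℓ = 2 ∧ NumberField.discr K % 8 = 5)))
    (hsplit : ∀ (ℓ : ℕ) [Fact ℓ.Prime], ¬ W.HasGoodReductionAtPrime ℓ → ℓ ∉ S →
      IsSquare (algebraMap ℚ ℚ_[ℓ] (NumberField.discr K : ℚ)))
    (hFC : ∀ (ℓ : ℕ) [Fact ℓ.Prime], ℓ ∉ S → W.HasSplitMultiplicativeReductionAtPrime ℓ →
      ¬ p ∣ padicValInt ℓ W.minimalDiscriminantInt) :
    padicValNat p W.tamagawaProduct + padicValNat p Wd.tamagawaProduct ≤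
      ∑ ℓ ∈ S, padicValNat p (padicValInt ℓ W.minimalDiscriminantInt) := by
  have hp : p.Prime := Fact.out
  have hfW : (W.badPlaces ℤ).Finite := W.finite_badPlaces_holds ℤ
  have hfWd : (Wd.badPlaces ℤ).Finite := Wd.finite_badPlaces_holds ℤ
  set s : Finset (HeightOneSpectrum ℤ) := hfW.toFinset ∪ hfWd.toFinset with hs
  have hsW : ∀ v, ¬ W.HasGoodReductionAt v → v ∈ s := fun v hv ↦
    Finset.mem_union_left _ (by rw [Set.Finite.mem_toFinset, mem_badPlaces_iff]; exact hv)
  have hsWd : ∀ v, ¬ Wd.HasGoodReductionAt v → v ∈ s := fun v hv ↦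
    Finset.mem_union_right _ (by rw [Set.Finite.mem_toFinset, mem_badPlaces_iff]; exact hv)
  set f : HeightOneSpectrum ℤ → ℕ := fun v ↦
    haveI := Fact.mk (primesEquiv v).2
    padicValNat p ((W.baseChange ℚ_[primesEquiv v]).localTamagawaNumber ℤ_[primesEquiv v]) +
      padicValNat p ((Wd.baseChange ℚ_[primesEquiv v]).localTamagawaNumber ℤ_[primesEquiv v]) with hf
  set g : ℕ → ℕ := fun ℓ ↦ padicValNat p (padicValInt ℓ W.minimalDiscriminantInt) with hg
  have hterm : ∀ v : HeightOneSpectrum ℤ,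
      f v ≤ if (primesEquiv v : ℕ) ∈ S then g (primesEquiv v : ℕ) else 0 := by
    intro v
    haveI := Fact.mk (primesEquiv v).2
    have key : ∀ (q : ℕ) (hq : Fact q.Prime), (primesEquiv v : ℕ) = q →
        padicValNat p (@WeierstrassCurve.localTamagawaNumber ℤ_[q] _ _ _ ℚ_[q] _ _ _ (W.baseChange ℚ_[q])) +
          padicValNat p (@WeierstrassCurve.localTamagawaNumber ℤ_[q] _ _ _ ℚ_[q] _ _ _ (Wd.baseChange ℚ_[q])) ≤
          if q ∈ S then g q else 0 := by
      rintro q hq hvq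
      by_cases hqS : q ∈ S
      · obtain ⟨_, hmult, hcase⟩ := hS q hqS
        rw [if_pos hqS, hg]
        rcases hcase with ⟨hq2, hJ⟩ | ⟨rfl, h8⟩
        · exact padicValNat_localTamagawaNumber_add_twist_le_of_inert W K Cd hWd q hq2 hJ p hp5 hmult
        · exact padicValNat_localTamagawaNumber_add_twist_le_of_inert_two W K Cd hWd h8 p hp5 hmult
      · rw [if_neg hqS, Nat.le_zero]
        by_cases hgood : W.HasGoodReductionAtPrime q
        · exact padicValNat_localTamagawaNumber_add_twist_eq_zero_of_good W K Cd hWd q p hp5 hgood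
        · exact padicValNat_localTamagawaNumber_add_twist_eq_zero_of_isSquare W K Cd hWd q p hp5
            (hsplit q hgood hqS) (hFC q hqS)
    exact key _ _ rfl
  rw [tamagawaProduct_eq_prod W s hsW, tamagawaProduct_eq_prod Wd s hsWd,
    padicValNat_finset_prod'' p s _ fun v _ ↦ ?_, padicValNat_finset_prod'' p s _ fun v _ ↦ ?_,
    ← Finset.sum_add_distrib]
  · calc ∑ v ∈ s, f v
        ≤ ∑ v ∈ s, (if (primesEquiv v : ℕ) ∈ S then g (primesEquiv v : ℕ) else 0) :=
          Finset.sum_le_sum fun v _ ↦ hterm v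
      _ = ∑ ℓ ∈ s.image (fun v ↦ (primesEquiv v : ℕ)), (if ℓ ∈ S then g ℓ else 0) := by
          rw [Finset.sum_image]
          intro v _ w _ h
          exact primesEquiv.injective (Subtype.ext h)
      _ ≤ ∑ ℓ ∈ S, g ℓ := by
          rw [← Finset.sum_filter]
          refine Finset.sum_le_sum_of_subset_of_nonneg (fun ℓ hℓ ↦ (Finset.mem_filter.mp hℓ).2)
            fun _ _ _ ↦ Nat.zero_le _
  · haveI := Fact.mk (primesEquiv v).2
    haveI : (W.baseChange ℚ_[primesEquiv v]).IsElliptic :=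
      inferInstanceAs (W.map (algebraMap ℚ ℚ_[primesEquiv v])).IsElliptic
    exact localTamagawaNumber_padic_ne_zero_holds (primesEquiv v) _
  · haveI := Fact.mk (primesEquiv v).2
    haveI : (Wd.baseChange ℚ_[primesEquiv v]).IsElliptic :=
      inferInstanceAs (Wd.map (algebraMap ℚ ℚ_[primesEquiv v])).IsElliptic
    exact localTamagawaNumber_padic_ne_zero_holds (primesEquiv v) _

/-- **X11b, (ram) atom, the WHOLE sub-shape (T2β)∖(T2α): the Euler-system half from the two
Shimura-curve shapes at a field of JSW §7.4.2 type, `2` allowed in `N⁻`.** For an X11b pair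
`(E,p)`, `p ≥ 5`, with a (ram) witness `ℓ₀`: given a quadratic field `K` and a finite set `S` of
primes, multiplicative for `E` and inert in `K` (`(d_K/ℓ) = −1`, resp. `d_K ≡ 5 mod 8` at `ℓ = 2`),
such that every bad prime outside `S` splits (so `p ∉ S` splits; `ℓ₀` inside or outside `S`), every
split multiplicative prime outside `S` très ramifié (`E` not split-and-peu-ramifié at `p`),
`L(E^{d_K},1) ≠ 0`, a globally minimal model `Wd` of the twist, and a point `P ∈ E(K)` with (U-Sh)
and (GZ-Sh) (`N⁻`-term `T = Σ_{ℓ∈S} ord_p(ord_ℓ Δ_min(E))`): `Typed.MissingUpperBoundAt E p` from the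
PUBLISHED facts `hSk`, `hGZK`, `hmod` and the tree's local theorems. CONDITIONAL on the two shapes
and the field; nothing booked; X11b stays CONSTRUCTION-SHAPED.
[cite: JetchevSkinnerWan2017, §7.4.2 (p. 31), Thm. 4.4.1 (p. 19), §4.1 (H) (p. 17)]
[cite: Skinner2016PacificMC, Thm. C (§1) and footnote 1] [cite: Miller2011LMS, Def. 1.1] -/
theorem missingUpperBoundAt_of_classX11b_of_shimuraShapes_inertSet'
    -- published inputs (named facts of the tree)
    (hSk : Skinner2016.thmC_padicValRat_bsd_rank_zero)
    (hGZK : rank_eq_analyticRank_of_analyticRank_le_one) (hmod : hasEntireLFunction_rat)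
    -- the pair, with a (ram) witness `ℓ₀`
    (W : WeierstrassCurve ℚ) [W.IsElliptic] [W.IsGloballyMinimal] (p : ℕ) [Fact p.Prime]
    (hX : ClassX11b W p) (hp5 : 5 ≤ p)
    {ℓ₀ : ℕ} [Fact ℓ₀.Prime] (hℓ₀ : ℓ₀ ≠ p) (hmult₀ : Mult W ℓ₀)
    (hram₀ : ¬ p ∣ padicValInt ℓ₀ W.minimalDiscriminantInt)
    -- the field and the inert set
    (K : Type) [Field K] [NumberField K] (h2 : Module.finrank ℚ K = 2) (S : Finset ℕ) (hpS : p ∉ S)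
    (hS : ∀ ℓ ∈ S, ∃ _ : Fact ℓ.Prime, Mult W ℓ ∧
      ((ℓ ≠ 2 ∧ jacobiSym (NumberField.discr K) ℓ = -1) ∨ (ℓ = 2 ∧ NumberField.discr K % 8 = 5)))
    (hsplit : ∀ (ℓ : ℕ) [Fact ℓ.Prime], ¬ W.HasGoodReductionAtPrime ℓ → ℓ ∉ S →
      IsSquare (algebraMap ℚ ℚ_[ℓ] (NumberField.discr K : ℚ)))
    (hFC : ∀ (ℓ : ℕ) [Fact ℓ.Prime], ℓ ∉ S → W.HasSplitMultiplicativeReductionAtPrime ℓ →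
      ¬ p ∣ padicValInt ℓ W.minimalDiscriminantInt)
    -- the twist
    (hLt : (W.quadraticTwist (NumberField.discr K : ℚ)).entireLFunction 1 ≠ 0)
    (Wd : WeierstrassCurve ℚ) [Wd.IsElliptic] [Wd.IsGloballyMinimal] (Cd : VariableChange ℚ)
    (hWd : Cd • W.quadraticTwist (NumberField.discr K : ℚ) = Wd)
    -- the point and the two shapes, with the `N⁻`-term of `S`
    (P : (W.baseChange K).toAffine.Point)
    (hGZSh : ∃ qE qd : ℚ, qE ≠ 0 ∧ qd ≠ 0 ∧
      W.leadingLCoeff / ((W.realPeriodRat : ℂ) * (W.regulator : ℂ)) = (qE : ℂ) ∧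
      Wd.entireLFunction 1 / (Wd.realPeriodRat : ℂ) = (qd : ℂ) ∧
      (2 * padicValNat p (AddSubgroup.zmultiples P).index : ℤ) +
          (∑ ℓ ∈ S, padicValNat p (padicValInt ℓ W.minimalDiscriminantInt) : ℕ) =
        padicValRat p qE + padicValRat p qd)
    (hUSh : Nat.card (AddCommGroup.primaryComponent (W.baseChange K).sha p) ≤
      p ^ (2 * padicValNat p (AddSubgroup.zmultiples P).index)) :
    Typed.MissingUpperBoundAt W p := by
  obtain ⟨hr, -, hmult, hirr⟩ := hX
  have hp2 : p ≠ 2 := by omega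
  have hp3 : 3 ≤ p := by omega
  have hD0 : (NumberField.discr K : ℚ) ≠ 0 := by exact_mod_cast NumberField.discr_ne_zero K
  haveI hEt : (W.quadraticTwist (NumberField.discr K : ℚ)).IsElliptic :=
    W.isElliptic_quadraticTwist hD0
  have hsqp : IsSquare (algebraMap ℚ ℚ_[p] (NumberField.discr K : ℚ)) :=
    hsplit p (WeierstrassCurve.HasMultiplicativeReduction.not_hasGoodReduction (R := ℤ_[p]) hmult) hpS
  have hT := padicValNat_tamagawaProduct_add_twist_le_of_inertSet' W p hp5 K Cd hWd S hS
    (fun ℓ _ hg hℓS ↦ hsplit ℓ hg hℓS) (fun ℓ _ hℓS hs ↦ hFC ℓ hℓS hs)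
  -- the twist: multiplicative at `p`, irreducible, (ram) through `ℓ₀` (split, odd inert or `2` inert)
  have hmultd : Wd.HasMultiplicativeReductionAtPrime p := by
    rw [← hWd, hasMultiplicativeReductionAtPrime_smul_iff]
    exact (hasMultiplicativeReductionAtPrime_quadraticTwist_iff W hD0 hsqp).mpr hmult
  have hirrd : Wd.HasIrreducibleModPGaloisRep p :=
    hasIrreducibleModPGaloisRep_twist_model W p K h2 hirr Cd hWd
  have hramd : Ram Wd p := by
    by_cases h0S : ℓ₀ ∈ S
    · obtain ⟨_, -, hcase⟩ := hS ℓ₀ h0S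
      rcases hcase with ⟨h02, hJ0⟩ | ⟨h0eq, h8⟩
      · exact ram_twist_of_inert_witness W K Cd hWd ℓ₀ h02 hJ0 p hℓ₀ hmult₀ hram₀
      · subst h0eq
        exact ram_twist_of_inert_witness_two W K Cd hWd h8 p hℓ₀ hmult₀ hram₀
    · have hsq₀ : IsSquare (algebraMap ℚ ℚ_[ℓ₀] (NumberField.discr K : ℚ)) :=
        hsplit ℓ₀ (WeierstrassCurve.HasMultiplicativeReduction.not_hasGoodReduction (R := ℤ_[ℓ₀])
          hmult₀) h0S
      refine ⟨ℓ₀, inferInstance, hℓ₀, ?_, ?_⟩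
      · rw [← hWd, hasMultiplicativeReductionAtPrime_smul_iff]
        exact (hasMultiplicativeReductionAtPrime_quadraticTwist_iff W hD0 hsq₀).mpr hmult₀
      · rwa [padicValInt_minimalDiscriminantInt_twist_eq W ℓ₀ hD0 hsq₀ Cd hWd]
  -- Skinner's Thm. C for the twist, then the bookkeeping core
  have hLt' : (W.quadraticTwist (NumberField.discr K : ℚ)).entireLFunction = Wd.entireLFunction := by
    rw [← hWd, entireLFunction_smul]
  have hLd1 : Wd.entireLFunction 1 ≠ 0 := by rw [← hLt']; exact hLt
  have hfinSd : Wd.ShaFinite := (hGZK Wd (by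
    rw [(Wd.analyticRank_eq_zero_iff_holds (hmod Wd)).2 hLd1]; omega)).2
  have hfinW : W.ShaFinite := (hGZK W (by omega)).2
  obtain ⟨qd, hqd, hvqd⟩ := hSk Wd p hp3 (Or.inr hmultd) hirrd hramd hLd1 hfinSd
  exact missingUpperBoundAt_of_shimuraShapes W p hp2 K h2 Wd ⟨Cd, hWd⟩ hfinW hfinSd P _ hT
    ⟨qd, hqd, hvqd.le⟩ hGZSh hUSh

end Summit.BirchSwinnertonDyer.Rank1Residual.X11b

end
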